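import Summits.BirchSwinnertonDyer.BirchSwinnertonDyer.Theorems.GenusKolyvaginAtTwoSupplyKernelsLossless
import HarnessLib

/-!
# SKELETON «s1_depth_zero» (LINE 25, ideator bsd-idea-1 g24) FOR THE RESIDUAL ITEM `OffCutResidualAtTwo` (stmt-BirchSwinnertonDyer-25503)
# — the ADDITIVE-ONLY slice S1 at depth zero (`#Sel₂(E) = 1`: 438 of the 496 S1 cells, 64 % of ALL 685 residual curves, N < 5·10⁵)
# needs NO multiplicative prime, NO Theorem B₂, NO new beyond-print statement: it is reached BY NAME from the two SUPPLY cruxes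
# (25504 / 23491, whose habitat has no cut), the LEAD's depth-zero kernels K₁⁺ / K₁ (LOSSLESS, p763825-class), gk2-p5 g34's v-free
# `Ш(E/K)[2^∞] = 0` (`GenusSupplyNarrow.Lossless.natCard_primaryComponent_sha_baseChange_two_eq_one_of_natCard_selmerGroup_eq_one`),
# `ExactDescentAtTwo` and `MinimalTwinBSDTwo`.

Composition `OffCutResidualAtTwo_of` concludes the ROUTE DECL `OffCutResidualAtTwo` BY NAME from FOUR stubs and EIGHT route items displayed as
hypotheses; `sorry` ONLY inside the four `stub_*`.  **BSD is NOT proved by this; no item is closed by it; nothing here is a theorem of the tree until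
landed.**  NOT registered with `ledger skeleton check` (W-79; 25503 is a declared residual — adoption is a rev-54 edit, see the card `s1_depth_zero.md`).

THE LINE.  `OffCutResidualAtTwo` asks BSD₂(E) outright on three slices; slice S1 = «no odd prime of multiplicative reduction» exists only because the
B₂/Q3_RT/Q4_T engine needs an odd multiplicative prime `v` as its NON-PHANTOM input (Lawson–Wuthrich).  But that input is consumed ONLY at positive
depth (`M₀ ≥ 1`, i.e. `Ш(E)[2] ≠ 0`): on the `#Sel₂(E) = 1` cells (i) the supply cruxes `GenusPrimitiveSupplyAtTwoPosDiscShallow` (Δ>0) and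
`GenusDeepSupplyAtTwoNegDiscNarrow` (Δ<0) apply VERBATIM — their habitat is (non-CM, `r_an = 0`, `ρ_{E,2^∞}` onto, odd Tamagawa, odd Manin, sign,
Selmer cell) with NO cut —, (ii) the depth-zero kernels K₁⁺ / K₁ (the `hK1` binders of `GenusSupplyPos.stubC_posDisc_of_selmerSplit` /
`GenusSupplyNarrow.stubC_negDisc_of_selmerSplit`, registered stubs of the LEAD's lines on 25504 / 23491, LOSSLESS = implied by the leaf modulo print,
`GenusSupplyNarrow.Lossless.K1_pos_of_nonCMAtTwo` / `K1_of_nonCMAtTwo`) force the supplied exponent `M₀ = 0`, (iii) gk2-p5's sign-free decoupled upper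
half gives `Ш(E/K)[2^∞] = 0 = 4^0` from `#Sel₂(E) = 1`, the minimal twin and its Tamagawa budget — with no multiplicative prime, no Q2, no print fact —,
(iv) `MinimalTwinBSDTwo` gives BSD₂ of the twin and `ExactDescentAtTwo` (four print facts) descends BSD₂(E/K) to BSD₂(E).  So S1 ∩ {`#Sel₂(E) = 1`}
is K₁-CLASS (leaf-equivalent), not residual.  The honest remainder of S1 is stub R₁′ («additive-only ∧ `#Sel₂(E) ≠ 1`»: 58 cells for N < 5·10⁵ —
there the non-phantom hypothesis (NPh) is a purely 2-adic question, gk2-p5 g20 `…RTNonPhantomAdditive`), and the cut-side disjuncts are stub R_cut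
verbatim (LINE 24 «strict_def2» treats their STRICT part).  Instrument S1-CENSUS (this folder, `s1_cells.tsv`, local 14 s scan of Cremona
`allbsd`): S1 = 158 (Δ>0) + 338 (Δ<0) cells; `Ш_an` odd (⇔ `#Sel₂(E) = 1` under BSD, used only to COUNT) on 134 + 304 = 438; remainder 24 + 34 = 58
(`4 ∥ Ш_an`: 20 + 24; `16 ∣ Ш_an`: 4 + 10).

References: [GrossLMS1991] §2 (2.2), §4 (4.1), §5 Prop. 5.3; [McCallumLMS1991] §5 Lemma 5.1, Cor. 5.6; [Kramer1981] Thm. 1, Prop. 3; [MazurRubin2010]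
Prop. 3.3, Cor. 3.4 (i); [GrossZagier1986] I.6.3, V.(2.2); [Milne1972ArithmeticAV] §1 Thm. 1; [LawsonWuthrich2016] §7.1, §8; [Kolyvagin1989Izv] Thm. B₂.
-/

set_option autoImplicit false
set_option linter.dupNamespace false -- `Summit.<P>.<Sub>` repeats `BirchSwinnertonDyer` (D-0017)

noncomputable section

open scoped Classical

namespace Summit.BirchSwinnertonDyer.BirchSwinnertonDyer.Cruxes.OffCutResidualAtTwo.S1DepthZero

open WeierstrassCurve NumberField Literature.NumberTheory.EllipticCurves Literature.NumberTheory.EllipticCurves.ModularForms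
  Literature.NumberTheory.GaloisRepresentations
  Summit.BirchSwinnertonDyer.BirchSwinnertonDyer.Theses.GenusKolyvaginAtTwo
  Summit.BirchSwinnertonDyer.BirchSwinnertonDyer.Theorems
  Summit.BirchSwinnertonDyer.BirchSwinnertonDyer.Theorems.GenusKoly
  Summit.BirchSwinnertonDyer.BirchSwinnertonDyer.Theorems.GenusSupplyNarrow.Lossless

/-! ## §1 The four stubs -/

/-- STUB K₁⁺ — VERBATIM the `hK1` binder of `GenusSupplyPos.stubC_posDisc_of_selmerSplit` (the LEAD's registered depth-zero kernel of crux 25504,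
`Cruxes/GenusPrimitiveSupplyAtTwoPosDiscShallow/Lines/genus_supply_pos_shallow.lean`): on a Δ>0 habitat curve with `#Sel₂(E) = 1`, in any
Kolyvagin-(H2)-admissible frame with a shallow minimal twin of analytic rank 1, the exponent `M₀` of `y_K = P(1)` is `0` (`1 ≤ M₀` is absurd).
BEYOND PRINT but LOSSLESS: implied by the leaf `NonCMAtTwo` modulo the four print items (`GenusSupplyNarrow.Lossless.K1_pos_of_nonCMAtTwo`, p763825
class); `M₀`-free form `GenusSupplyPos.K1_pos_of_not_two_dvd`.  Staffing is SHARED with 25504's K₁⁺ — this is the same statement, not a new item.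
Why it might fail: it is Kolyvagin's non-divisibility `y_K ∉ 2E(K) + E(K)_tors` on the `Ш(E)[2] = 0` cells, i.e. BSD₂(E/K) there (Gross–Zagier); the
instrument row that would refute it: a `#Sel₂(E) = 1` habitat cell with a shallow minimal twin and EVEN Heegner index `[E(K) : ℤ y_K]` (none known;
Gross–Zagier + BSD predict odd).  [cite: GrossLMS1991, §2 Conj. (2.2), §4 (4.1)]
[cite: McCallumLMS1991, §5 Lemma 5.1] -/
theorem stub_K1_pos :
    ∀ (W : WeierstrassCurve ℚ) [W.IsElliptic] [W.IsGloballyMinimal] [NeZero (W.conductorNorm ℤ)],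
    ¬ W.HasCM → W.analyticRank = 0 → (∀ n : ℕ, 0 < n → W.HasSurjectiveModNGaloisRep ((2 : ℤ) ^ n)) →
    Odd W.tamagawaProduct → 0 < W.Δ →
    Nat.card (W.selmerGroup 2) = 1 →
    ∀ (K : Type) [Field K] [NumberField K],
    IsImaginaryQuadratic K → Odd (NumberField.discr K) → NumberField.discr K ≠ -3 →
    SatisfiesHeegnerHypothesis (W.conductorNorm ℤ) K →
    ¬ IsSquare ((NumberField.discr K : ℚ) * -|W.Δ|) → ¬ IsSquare ((NumberField.discr K : ℚ) * (-(2 * |W.Δ|))) →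
    ∀ (Dt : ModularParametrizationData W (W.conductorNorm ℤ)),
    (∀ z ∈ Dt.L.lattice, ∃ w ∈ periodLattice Dt.f, z = (Dt.c : ℂ) * w) → Odd Dt.c →
    ∀ (β : ℤ) (ι : K →+* ℂ) (d₁ : KolyvaginHeegnerData Dt β ι 1), ¬ IsOfFinAddOrder d₁.derivedPoint →
    ∀ (M₀ : ℕ), (∃ Q : (W.baseChange (ringClassField K ι 1)).toAffine.Point, ((2 ^ M₀ : ℕ) : ℤ) • Q = d₁.derivedPoint) →
    (¬ ∃ Q : (W.baseChange (ringClassField K ι 1)).toAffine.Point, ((2 ^ (M₀ + 1) : ℕ) : ℤ) • Q = d₁.derivedPoint) →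
    1 ≤ M₀ →
    ∀ (Wd : WeierstrassCurve ℚ) [Wd.IsElliptic] [Wd.IsGloballyMinimal],
    (∃ C : WeierstrassCurve.VariableChange ℚ, C • W.quadraticTwist (NumberField.discr K : ℚ) = Wd) →
    Wd.analyticRank = 1 → Nat.card (Wd.selmerGroup 2) = 2 → padicValNat 2 Wd.tamagawaProduct = 0 →
    False := by
  sorry

/-- STUB K₁ — VERBATIM the `hK1` binder of `GenusSupplyNarrow.stubC_negDisc_of_selmerSplit` (the LEAD's registered depth-zero kernel of crux 23491):
the Δ<0 twin of K₁⁺ (twin Tamagawa budget `ord₂ c(Wd) ≤ 1`: one transposition prime).  BEYOND PRINT, LOSSLESS (`GenusSupplyNarrow.Lossless.K1_of_nonCMAtTwo`);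
staffing SHARED with 23491's K₁.  [cite: GrossLMS1991, §2 Conj. (2.2), §4 (4.1)] [cite: McCallumLMS1991, §5 Lemma 5.1] -/
theorem stub_K1_neg :
    ∀ (W : WeierstrassCurve ℚ) [W.IsElliptic] [W.IsGloballyMinimal] [NeZero (W.conductorNorm ℤ)],
    ¬ W.HasCM → W.analyticRank = 0 → (∀ n : ℕ, 0 < n → W.HasSurjectiveModNGaloisRep ((2 : ℤ) ^ n)) →
    Odd W.tamagawaProduct → W.Δ < 0 → Nat.card (W.selmerGroup 2) = 1 →
    ∀ (K : Type) [Field K] [NumberField K],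
    IsImaginaryQuadratic K → Odd (NumberField.discr K) → NumberField.discr K ≠ -3 →
    SatisfiesHeegnerHypothesis (W.conductorNorm ℤ) K →
    ¬ IsSquare ((NumberField.discr K : ℚ) * -|W.Δ|) → ¬ IsSquare ((NumberField.discr K : ℚ) * (-(2 * |W.Δ|))) →
    ∀ (Dt : ModularParametrizationData W (W.conductorNorm ℤ)),
    (∀ z ∈ Dt.L.lattice, ∃ w ∈ periodLattice Dt.f, z = (Dt.c : ℂ) * w) → Odd Dt.c →
    ∀ (β : ℤ) (ι : K →+* ℂ) (d₁ : KolyvaginHeegnerData Dt β ι 1), ¬ IsOfFinAddOrder d₁.derivedPoint →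
    ∀ (M₀ : ℕ), (∃ Q : (W.baseChange (ringClassField K ι 1)).toAffine.Point, ((2 ^ M₀ : ℕ) : ℤ) • Q = d₁.derivedPoint) →
    (¬ ∃ Q : (W.baseChange (ringClassField K ι 1)).toAffine.Point, ((2 ^ (M₀ + 1) : ℕ) : ℤ) • Q = d₁.derivedPoint) →
    1 ≤ M₀ →
    ∀ (Wd : WeierstrassCurve ℚ) [Wd.IsElliptic] [Wd.IsGloballyMinimal],
    (∃ C : WeierstrassCurve.VariableChange ℚ, C • W.quadraticTwist (NumberField.discr K : ℚ) = Wd) →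
    Wd.analyticRank = 1 → Nat.card (Wd.selmerGroup 2) = 2 → padicValNat 2 Wd.tamagawaProduct ≤ 1 →
    False := by
  sorry

/-- STUB R₁′ — RESIDUAL SLICE (declared residual, NOT a lemma of the line; SIGN-FREE): habitat curves with NO odd prime of multiplicative reduction AND
`#Sel₂(E) ≠ 1` (N < 5·10⁵: 58 cells = 24 (Δ>0) + 34 (Δ<0); 12 % of S1, 8.5 % of the rev-53 residual).  WHY NO ENGINE: at positive depth the pair
Čebotarev needs the non-phantom hypothesis (NPh); odd additive primes with odd `c_p` are SILENT for it (`H¹(ℚ_p, E[2^k]) = 0`, gk2-p5 g20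
`…RTNonPhantomAdditive`), so (NPh) is decided at the places over `2` only — untyped.  [cite: LawsonWuthrich2016, §7.1, §8] -/
theorem stub_residualAdditiveNontrivialSelmerAtTwo :
    ∀ (W : WeierstrassCurve ℚ) [W.IsElliptic] [W.IsGloballyMinimal] [NeZero (W.conductorNorm ℤ)], ¬ W.HasCM → W.analyticRank = 0 → (∀ n : ℕ, 0 < n → W.HasSurjectiveModNGaloisRep ((2 : ℤ) ^ n)) → Odd W.tamagawaProduct → (∃ Dt : Literature.NumberTheory.EllipticCurves.ModularForms.ModularParametrizationData W (W.conductorNorm ℤ), (∀ z ∈ Dt.L.lattice, ∃ w ∈ Literature.NumberTheory.EllipticCurves.ModularForms.periodLattice Dt.f, z = (Dt.c : ℂ) * w) ∧ Odd Dt.c) → (¬ (∃ v : IsDedekindDomain.HeightOneSpectrum (NumberField.RingOfIntegers ℚ), ((2 : ℕ) : NumberField.RingOfIntegers ℚ) ∉ v.asIdeal ∧ ((W.conductorNorm ℤ : ℕ) : NumberField.RingOfIntegers ℚ) ∈ v.asIdeal ∧ W.HasMultiplicativeReductionAt v)) → Nat.card (W.selmerGroup 2) ≠ 1 → Literature.NumberTheory.EllipticCurves.BSDp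 W 2 := by
  sorry

/-- STUB R_cut — RESIDUAL SLICE (declared residual, NOT a lemma of the line): the crux's 2nd and 3rd disjuncts VERBATIM (Δ<0 wide Selmer; Δ>0 not
real-narrow), restricted to the CUT (an odd multiplicative prime exists — off the cut the depth-zero engine or R₁′ apply).  LINE 24 «strict_def2»
(`Lines/strict_def2.lean`) moves the STRICT part of the 3rd disjunct to K₄-class; the WIDE parts are empty for N < 5·10⁵ on Δ>0 and the 2nd disjunct on
Δ<0 (ACCT-S3-g22, rev-42 census).  [cite: MazurRubin2010, Prop. 3.3, Cor. 3.4 (i)] -/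
theorem stub_residualOnCutAtTwo :
    ∀ (W : WeierstrassCurve ℚ) [W.IsElliptic] [W.IsGloballyMinimal] [NeZero (W.conductorNorm ℤ)], ¬ W.HasCM → W.analyticRank = 0 → (∀ n : ℕ, 0 < n → W.HasSurjectiveModNGaloisRep ((2 : ℤ) ^ n)) → Odd W.tamagawaProduct → (∃ Dt : Literature.NumberTheory.EllipticCurves.ModularForms.ModularParametrizationData W (W.conductorNorm ℤ), (∀ z ∈ Dt.L.lattice, ∃ w ∈ Literature.NumberTheory.EllipticCurves.ModularForms.periodLattice Dt.f, z = (Dt.c : ℂ) * w) ∧ Odd Dt.c) → (∃ v : IsDedekindDomain.HeightOneSpectrum (NumberField.RingOfIntegers ℚ), ((2 : ℕ) : NumberField.RingOfIntegers ℚ) ∉ v.asIdeal ∧ ((W.conductorNorm ℤ : ℕ) : NumberField.RingOfIntegers ℚ) ∈ v.asIdeal ∧ W.HasMultiplicativeReductionAt v) → ((W.Δ < 0 ∧ ¬ (Nat.card (W.selmerGroup 2) = 1 ∨ Nat.card (W.selmerGroup 2) = 4)) ∨ (0 < W.Δ ∧ ¬ (Nat.card (W.selmerGroup 2) = 1 ∨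 (Nat.card (W.selmerGroup 2) = 4 ∧ ∃ c ∈ (W.kummerSelmerStructure ((2 : ℕ) : ℤ)).selmerGroup, Literature.NumberTheory.GaloisRepresentations.galoisCohomology.localization (W.torsionGaloisModule ((2 : ℕ) : ℤ)) (Sum.inl Rat.infinitePlace) 1 c ≠ 0)))) → Literature.NumberTheory.EllipticCurves.BSDp W 2 := by
  sorry

/-! ## §2 Composition: `OffCutResidualAtTwo` BY NAME from the four stubs and EIGHT route items displayed as hypotheses -/

/-- COMPOSITION (sorry-free outside the four stubs).  The depth-zero ENGINE (`#Sel₂(E) = 1`, any sign, NO multiplicative prime): the supply crux of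
the sign (items 25504 / 23491, VERBATIM — their habitat has no cut) gives the Heegner field `K`, the frame `(Dt, β, ι, d₁)`, `y_K` of infinite order,
McCallum's exponent `M₀` and a minimal twin `Wd` (non-CM, `r_an(Wd) = 1`, `#Sel₂(Wd) = 2`, Tamagawa budget of the sign); K₁⁺ / K₁ force `M₀ = 0`;
gk2-p5 g34's v-free decoupled upper half gives `#Ш(E/K)[2^∞] = 1 = 2^(2·0)`; `MinimalTwinBSDTwo` gives BSD₂(Wd); `ExactDescentAtTwo` (from its four
print facts) descends to BSD₂(E).  Case split of the crux's hypothesis: on the cut only the 2nd/3rd disjuncts can hold → R_cut; off the cut: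
`#Sel₂(E) = 1` → ENGINE, else → R₁′.  Route items used BY NAME: GenusPrimitiveSupplyAtTwoPosDiscShallow (25504), GenusDeepSupplyAtTwoNegDiscNarrow
(23491), ExactDescentAtTwoOfFourFacts, MinimalTwinBSDTwo, GrossZagierAllLevels, EntireLFunctionRat, MultPublishedInputsAtTwo, MilneAnyModel.
NOT used: KolyvaginRelationAtTwo (Q2), the Q3_RT / Q4_T exactness items, the 2-converse pair, Modularity, 2-parity — the depth-zero slice needs none.
BSD is NOT proved by this. -/
theorem OffCutResidualAtTwo_of (hP : GenusPrimitiveSupplyAtTwoPosDiscShallow) (hPG : GenusDeepSupplyAtTwoNegDiscNarrow)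
    (hGf : ExactDescentAtTwoOfFourFacts) (hTw : MinimalTwinBSDTwo) (hGZ : GrossZagierAllLevels) (hL : EntireLFunctionRat)
    (hGZK : MultPublishedInputsAtTwo) (hMi : MilneAnyModel) :
    OffCutResidualAtTwo := by
  have hG : ExactDescentAtTwo := hGf ⟨hGZ, hGZK, hL, hMi⟩
  intro W _ _ _ hcm hr0 hρ hT hopt hslice
  have hs2 : W.HasSurjectiveModNGaloisRep 2 := by simpa using hρ 1 one_pos
  -- the depth-zero ENGINE: `#Sel₂(E) = 1`, either sign, no multiplicative prime anywhere
  have engine : Nat.card (W.selmerGroup 2) = 1 → BSDp W 2 := by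
    intro h1
    rcases lt_or_gt_of_ne W.isUnit_Δ.ne_zero with hneg | hpos
    · -- Δ < 0: deep supply (23491) on its `#Sel₂ = 1` cell, K₁, v-free `Ш(E/K)[2^∞] = 0`, U₂, exact descent
      obtain ⟨K, iF, iN, hIQ, hodd, h3, hHe, hsq1, hsq2, Dt, β, ι, d₁, hoptDt, hc, hy, M₀, hdiv, hndiv, n, d, hn, hKoly, hPn,
        Wd, iE, iM, hWd, hcmd, hrd, hSel, hDEF⟩ := hPG W hcm hr0 hρ hT hneg hopt (Or.inl h1)
      have hM0 : M₀ = 0 := by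
        by_contra hne
        exact stub_K1_neg W hcm hr0 hρ hT hneg h1 K hIQ hodd h3 hHe hsq1 hsq2 Dt hoptDt hc β ι d₁ hy M₀ hdiv hndiv
          (Nat.one_le_iff_ne_zero.mpr hne) Wd hWd hrd hSel hDEF
      subst hM0
      have hSha : Nat.card (AddCommGroup.primaryComponent (W.baseChange K).sha 2) = 2 ^ (2 * 0) := by
        rw [mul_zero, pow_zero]
        exact natCard_primaryComponent_sha_baseChange_two_eq_one_of_natCard_selmerGroup_eq_one W K hT hr0 h1 hIQ hodd hHe hs2
          Dt β ι d₁ hy 0 hndiv Wd hWd hSel (Or.inl ⟨hneg, hDEF⟩)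
      exact hG W hcm hr0 hρ hT K hIQ hodd h3 hHe Dt hoptDt hc β ι d₁ hy 0 hdiv hndiv hSha Wd hWd hSel (hTw Wd hcmd hrd hSel)
    · -- Δ > 0: shallow supply (25504) on its `#Sel₂ = 1` cell, K₁⁺, v-free `Ш(E/K)[2^∞] = 0`, U₂, exact descent
      obtain ⟨K, iF, iN, hIQ, hodd, h3, hHe, hsq1, hsq2, Dt, β, ι, d₁, hoptDt, hc, hy, M₀, hdiv, hndiv, n, d, hn, hKoly, hPn,
        Wd, iE, iM, hWd, hcmd, hrd, hSel, hDEF⟩ := hP W hcm hr0 hρ hT hpos hopt (Or.inl h1)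
      have hM0 : M₀ = 0 := by
        by_contra hne
        exact stub_K1_pos W hcm hr0 hρ hT hpos h1 K hIQ hodd h3 hHe hsq1 hsq2 Dt hoptDt hc β ι d₁ hy M₀ hdiv hndiv
          (Nat.one_le_iff_ne_zero.mpr hne) Wd hWd hrd hSel hDEF
      subst hM0
      have hSha : Nat.card (AddCommGroup.primaryComponent (W.baseChange K).sha 2) = 2 ^ (2 * 0) := by
        rw [mul_zero, pow_zero]
        exact natCard_primaryComponent_sha_baseChange_two_eq_one_of_natCard_selmerGroup_eq_one W K hT hr0 h1 hIQ hodd hHe hs2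
          Dt β ι d₁ hy 0 hndiv Wd hWd hSel (Or.inr ⟨hpos, hDEF⟩)
      exact hG W hcm hr0 hρ hT K hIQ hodd h3 hHe Dt hoptDt hc β ι d₁ hy 0 hdiv hndiv hSha Wd hWd hSel (hTw Wd hcmd hrd hSel)
  by_cases hmult : ∃ v : IsDedekindDomain.HeightOneSpectrum (NumberField.RingOfIntegers ℚ),
      ((2 : ℕ) : NumberField.RingOfIntegers ℚ) ∉ v.asIdeal ∧
      ((W.conductorNorm ℤ : ℕ) : NumberField.RingOfIntegers ℚ) ∈ v.asIdeal ∧ W.HasMultiplicativeReductionAt v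
  · -- on the cut only the 2nd / 3rd disjuncts can hold: residual R_cut (its STRICT part is LINE 24's)
    rcases hslice with hadd | hrest | hrest
    · exact (hadd hmult).elim
    · exact stub_residualOnCutAtTwo W hcm hr0 hρ hT hopt hmult (Or.inl hrest)
    · exact stub_residualOnCutAtTwo W hcm hr0 hρ hT hopt hmult (Or.inr hrest)
  · -- additive-only: depth zero → ENGINE; positive depth → residual R₁′
    by_cases h1 : Nat.card (W.selmerGroup 2) = 1
    · exact engine h1
    · exact stub_residualAdditiveNontrivialSelmerAtTwo W hcm hr0 hρ hT hopt hmult h1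

end Summit.BirchSwinnertonDyer.BirchSwinnertonDyer.Cruxes.OffCutResidualAtTwo.S1DepthZero

end
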